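import Literature.NumberTheory.EllipticCurves.PadicLogFiniteExtensionVariableChangeProofs
import HarnessLib

/-!
# `log_ω` under a general change of variables, II: the case `|u| ≥ 1`, the equivalence spellings,
# and the hypothesis-free forms over a complete nonarchimedean normed field — PROVED

Topic `NumberTheory/EllipticCurves`; sequel of `PadicLogFiniteExtensionVariableChangeProofs.lean`
(`padicLogPointFiniteExt_pointMap_of_variableChange`: `log_{ω'}(ι_C P) = u · log_ω(P)` for
`C = (u, r, s, t)` with `|u| ≤ 1` between two integral models over a valued field, no hypothesis on
`r, s, t`). THEOREMS ONLY. Cell `bsd-schneider-ideate`, seat `bsd-schneider-door-c3` (prover, gen 10);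
consumer: the twist descent of Castella–Hsieh's value formula (route `SchneiderFreeAdditiveX3`, input
`KYRead.KYReadCHValue`, item stmt-BirchSwinnertonDyer-19177), where the composite change
`C₂ · ι_θ⁻¹ · D` has `|u| = |θ|⁻¹ > 1` in one direction.

* `padicLogPointFiniteExt_pointEquiv_of_variableChange`, `…_pointEquiv_symm_of_variableChange` — the
  statements of part I along `pointEquiv V C` and its inverse;
* `padicLogPointFiniteExt_pointMap_of_variableChange_of_one_le` — **`|u| ≥ 1`**: for every point whose
  IMAGE has a positive multiple in the level of `C • V`, by part I applied to
  `C⁻¹ = (u⁻¹, −r u⁻², −s u⁻¹, (rs − t) u⁻³)` acting on `C • V` and transported along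
  `C⁻¹ • (C • V) = V` (`pointMap_inv_pointMap`, `padicLogPointFiniteExt_congrEquiv`);
* section `Normed`: the same over `ℚ_p`, `ℂ_p`, finite extensions of `ℚ_p`, completions `K_v`
  (`[NontriviallyNormedField K] [IsUltrametricDist K] [CompleteSpace K]`, `w = ‖·‖₊`), with the (SPEC)
  hypotheses discharged by `limitLog_spec_of_completeSpace`.

References: Silverman, *AEC* III.1 Table 3.1 (`u⁻¹ω' = ω`), Prop. III.3.1(b), Thm. IV.6.4, Prop.
VII.2.2; Mazur–Tate–Teitelbaum 1986 §II.
-/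

noncomputable section

open scoped Classical NNReal

namespace Literature.NumberTheory.EllipticCurves.FormalGroupChart

open _root_.WeierstrassCurve _root_.WeierstrassCurve.VariableChange

section Log

variable {K : Type*} [Field K] {w : Valuation K ℝ≥0} {V : WeierstrassCurve K} {p : ℕ}
  {C : _root_.WeierstrassCurve.VariableChange K}
  [hV : V.IsIntegral w.integer] [hV' : (C • V).IsIntegral w.integer]


/-- The same along the additive equivalence `pointEquiv V C` (`= pointMap`, by definition).
[cite: SilvermanAEC2009, III.1 Table 3.1 with Thm. IV.6.4] -/
theorem padicLogPointFiniteExt_pointEquiv_of_variableChange (hp0 : (p : K) ≠ 0)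
    (hp1 : w (p : K) < 1) (hu : w (C.u : K) ≤ 1)
    (hℓ : ∀ Q ∈ level w V (w (p : K)), ∀ r : ℕ,
      w (limitLog w V p Q - ((p ^ r) • Q).zCoord / (p : K) ^ r) ≤ w (p : K) ^ (r + 1))
    (hℓ' : ∀ Q ∈ level w (C • V) (w (p : K)), ∀ r : ℕ,
      w (limitLog w (C • V) p Q - ((p ^ r) • Q).zCoord / (p : K) ^ r) ≤ w (p : K) ^ (r + 1))
    {P : V.toAffine.Point} {m : ℕ} (hm : 0 < m) (hmP : m • P ∈ level w V (w (p : K))) :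
    padicLogPointFiniteExt w (C • V) p (pointEquiv V C P) =
      (C.u : K) * padicLogPointFiniteExt w V p P := by
  rw [pointEquiv_apply]
  exact padicLogPointFiniteExt_pointMap_of_variableChange hp0 hp1 hu hℓ hℓ' hm hmP

/-- The same along `(pointEquiv V C).symm` (`= pointInv`, by definition).
[cite: SilvermanAEC2009, III.1 Table 3.1 with Thm. IV.6.4] -/
theorem padicLogPointFiniteExt_pointEquiv_symm_of_variableChange (hp0 : (p : K) ≠ 0)
    (hp1 : w (p : K) < 1) (hu : w (C.u : K) ≤ 1)
    (hℓ : ∀ Q ∈ level w V (w (p : K)), ∀ r : ℕ,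
      w (limitLog w V p Q - ((p ^ r) • Q).zCoord / (p : K) ^ r) ≤ w (p : K) ^ (r + 1))
    (hℓ' : ∀ Q ∈ level w (C • V) (w (p : K)), ∀ r : ℕ,
      w (limitLog w (C • V) p Q - ((p ^ r) • Q).zCoord / (p : K) ^ r) ≤ w (p : K) ^ (r + 1))
    {P' : (C • V).toAffine.Point} {m : ℕ} (hm : 0 < m)
    (hmP : m • (pointEquiv V C).symm P' ∈ level w V (w (p : K))) :
    padicLogPointFiniteExt w V p ((pointEquiv V C).symm P') =
      (C.u : K)⁻¹ * padicLogPointFiniteExt w (C • V) p P' := by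
  rw [pointEquiv_symm_apply] at hmP ⊢
  exact padicLogPointFiniteExt_pointInv_of_variableChange hp0 hp1 hu hℓ hℓ' hm hmP

/-! ### The case `|u| ≥ 1` -/

/-- **`log_{ω'}(ι_C P) = u · log_ω(P)` for a general change of variables with `|u| ≥ 1`**, for every
point `P` whose IMAGE has a positive multiple in the level of `C • V`: the case `|u⁻¹| ≤ 1` applied to
`C⁻¹ = (u⁻¹, −r u⁻², −s u⁻¹, (rs − t) u⁻³)` acting on `C • V`, transported along `C⁻¹ • (C • V) = V`.
[cite: SilvermanAEC2009, III.1 Table 3.1 with Thm. IV.6.4 and Prop. VII.2.2] -/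
theorem padicLogPointFiniteExt_pointMap_of_variableChange_of_one_le (hp0 : (p : K) ≠ 0)
    (hp1 : w (p : K) < 1) (hu : 1 ≤ w (C.u : K))
    (hℓ : ∀ Q ∈ level w V (w (p : K)), ∀ r : ℕ,
      w (limitLog w V p Q - ((p ^ r) • Q).zCoord / (p : K) ^ r) ≤ w (p : K) ^ (r + 1))
    (hℓ' : ∀ Q ∈ level w (C • V) (w (p : K)), ∀ r : ℕ,
      w (limitLog w (C • V) p Q - ((p ^ r) • Q).zCoord / (p : K) ^ r) ≤ w (p : K) ^ (r + 1))
    {P : V.toAffine.Point} {m : ℕ} (hm : 0 < m)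
    (hmP : m • pointMap V C P ∈ level w (C • V) (w (p : K))) :
    padicLogPointFiniteExt w (C • V) p (pointMap V C P) =
      (C.u : K) * padicLogPointFiniteExt w V p P := by
  haveI hV'' : (C⁻¹ • (C • V)).IsIntegral w.integer := by rw [inv_smul_smul]; exact hV
  have hu0 : (C.u : K) ≠ 0 := C.u.ne_zero
  have hu' : w ((C⁻¹).u : K) ≤ 1 := by
    rw [inv_def, Units.val_inv_eq_inv_val, map_inv₀]
    exact inv_le_one_of_one_le₀ hu
  have hℓ'' := limitLog_spec_congr (w := w) (p := p) (inv_smul_smul C V).symm hℓ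
  have key := padicLogPointFiniteExt_pointMap_of_variableChange (V := C • V) (C := C⁻¹) hp0 hp1 hu'
    hℓ' hℓ'' hm hmP
  rw [pointMap_inv_pointMap, padicLogPointFiniteExt_congrEquiv] at key
  rw [key, inv_def, Units.val_inv_eq_inv_val, ← mul_assoc, mul_inv_cancel₀ hu0, one_mul]

end Log

/-! ### Over a complete nonarchimedean normed field: no (SPEC) hypotheses -/

section Normed

variable {K : Type*} [NontriviallyNormedField K] [IsUltrametricDist K] [CompleteSpace K]
  {V : WeierstrassCurve K} {C : _root_.WeierstrassCurve.VariableChange K}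
  [hV : V.IsIntegral (NormedField.valuation (K := K)).integer]
  [hV' : (C • V).IsIntegral (NormedField.valuation (K := K)).integer] {p : ℕ}

/-- **`log_{ω'}(ι_C P) = u · log_ω(P)`, `|u| ≤ 1`, over a complete nonarchimedean normed field**
(`ℚ_p`, `ℂ_p`, a finite extension of `ℚ_p`, a completion `K_v`): for every point with a positive
multiple in the level of `V`. [cite: SilvermanAEC2009, III.1 Table 3.1 with Thm. IV.6.4 and Prop. VII.2.2] -/
theorem padicLogPointFiniteExt_pointMap_of_variableChange_of_completeSpace (hp0 : (p : K) ≠ 0)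
    (hp1 : NormedField.valuation (p : K) < 1) (hu : NormedField.valuation (C.u : K) ≤ 1)
    {P : V.toAffine.Point} {m : ℕ} (hm : 0 < m)
    (hmP : m • P ∈ level NormedField.valuation V (NormedField.valuation (p : K))) :
    padicLogPointFiniteExt NormedField.valuation (C • V) p (pointMap V C P) =
      (C.u : K) * padicLogPointFiniteExt NormedField.valuation V p P :=
  padicLogPointFiniteExt_pointMap_of_variableChange hp0 hp1 hu (limitLog_spec_of_completeSpace hp0 hp1)
    (limitLog_spec_of_completeSpace hp0 hp1) hm hmP

/-- **`log_{ω'}(ι_C P) = u · log_ω(P)`, `|u| ≥ 1`, over a complete nonarchimedean normed field**: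
for every point whose image has a positive multiple in the level of `C • V`.
[cite: SilvermanAEC2009, III.1 Table 3.1 with Thm. IV.6.4 and Prop. VII.2.2] -/
theorem padicLogPointFiniteExt_pointMap_of_variableChange_of_one_le_of_completeSpace
    (hp0 : (p : K) ≠ 0) (hp1 : NormedField.valuation (p : K) < 1)
    (hu : 1 ≤ NormedField.valuation (C.u : K)) {P : V.toAffine.Point} {m : ℕ} (hm : 0 < m)
    (hmP : m • pointMap V C P ∈ level NormedField.valuation (C • V) (NormedField.valuation (p : K))) :
    padicLogPointFiniteExt NormedField.valuation (C • V) p (pointMap V C P) =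
      (C.u : K) * padicLogPointFiniteExt NormedField.valuation V p P :=
  padicLogPointFiniteExt_pointMap_of_variableChange_of_one_le hp0 hp1 hu
    (limitLog_spec_of_completeSpace hp0 hp1) (limitLog_spec_of_completeSpace hp0 hp1) hm hmP

/-- **The inverse map over a complete nonarchimedean normed field, `|u| ≤ 1`**: `log_ω(ι_C⁻¹ P') =
u⁻¹ · log_{ω'}(P')`. [cite: SilvermanAEC2009, III.1 Table 3.1 with Thm. IV.6.4 and Prop. VII.2.2] -/
theorem padicLogPointFiniteExt_pointInv_of_variableChange_of_completeSpace (hp0 : (p : K) ≠ 0)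
    (hp1 : NormedField.valuation (p : K) < 1) (hu : NormedField.valuation (C.u : K) ≤ 1)
    {P' : (C • V).toAffine.Point} {m : ℕ} (hm : 0 < m)
    (hmP : m • pointInv V C P' ∈ level NormedField.valuation V (NormedField.valuation (p : K))) :
    padicLogPointFiniteExt NormedField.valuation V p (pointInv V C P') =
      (C.u : K)⁻¹ * padicLogPointFiniteExt NormedField.valuation (C • V) p P' :=
  padicLogPointFiniteExt_pointInv_of_variableChange hp0 hp1 hu (limitLog_spec_of_completeSpace hp0 hp1)
    (limitLog_spec_of_completeSpace hp0 hp1) hm hmP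

end Normed

end Literature.NumberTheory.EllipticCurves.FormalGroupChart

end
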